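import Summits.SmoothPoincare4.SmoothPoincare4.Theorems.CylinderEntropyCylinderRungTwoHamiltonMonotonicityDivergence
import Summits.SmoothPoincare4.SmoothPoincare4.Theorems.CylinderEntropyCylinderRungTwoTiltExcess
import Summits.SmoothPoincare4.SmoothPoincare4.Theorems.CylinderEntropyCylinderRungTwoGaussianWeightCalculus
import HarnessLib

/-!
# Route `CylinderEntropy`, crux `CylinderRungTwo` (stmt-SmoothPoincare4-7631), line `killing-flux`:
# the static Gaussian monotonicity identity on a closed cross-section of `N = S⁴ × ℝ`
# (registered helper `helper_staticMonotonicityIdentity`)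

For a closed immersed cross-section `f : M⁴ → N = S⁴ × ℝ = {z ∈ ℝ⁶ | ∑_{i<5} zᵢ² = 1}` with smooth
unit normal `ν` tangent to `N`, mean curvature `H` (tree `meanCurvature` of `(f, ν)` in `ℝ⁶`),
radial normal `n = (z', 0) ∘ f` of `N`, `S = |ν'|² = ∑_{i<5} νᵢ²`, and the Gaussian weight
`G(z) = exp(-|z - x₀|² / (4τ)) / (4πτ)²` (`x₀ ∈ ℝ⁶`, `τ > 0`), with `r = f(w) - x₀`:

  `∫_M G(f w) [ (|r|² - ⟨r, n⟩² - ⟨r, ν⟩²) / (4τ²) - 2/τ + ((4 - S) ⟨r, n⟩ + H ⟨r, ν⟩) / (2τ) ] dμ_g = 0`,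

`μ_g` the Riemannian measure of `g = f^*δ`. This is Green's identity `∫_M Δ_g(G ∘ f) dμ_g = 0` in
its landed ambient form (`integral_sliceLaplacian_eq_zero`, `…HamiltonMonotonicityDivergence.lean`),
whose integrand `(Δ_{ℝ⁶}G - D²G(n,n) - 4 DG(n)) - (D²G(ν,ν) - S DG(n)) - H DG(ν)` at `f w` collapses
POINTWISE to the displayed bracket by the calculus of `G` (`…GaussianWeightCalculus.lean`:
`DG_z(v) = -G ⟨r, v⟩ / (2τ)`, `D²G_z(v, v) = G (⟨r, v⟩² / (4τ²) - |v|² / (2τ))`,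
`Δ_{ℝ⁶} G = G (|r|² / (4τ²) - 3/τ)`) and `|n| = |ν| = 1`. It is the first-variation identity behind
the static Gaussian (Colding–Minicozzi `F`-functional / Ecker) monotonicity for cross-sections of
`N`: the tangential part `|r^T|² = |r|² - ⟨r, n⟩² - ⟨r, ν⟩²` and the normal mean curvature vector
`-H ν - (4 - S) n` of `f(M) ⊂ ℝ⁶` appear with the weight `G`.

* `staticMonotonicity_identity` — the identity, with implicit binders;
* `helper_staticMonotonicityIdentity` — the registered helper, verbatim.

Everything here is PROVED (no `sorry`, no new definitions, no named facts).

References: R. S. Hamilton, Comm. Anal. Geom. 1 (1993) 127–137, §4 (Green's identity on slices of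
`S⁴ × ℝ`); T. H. Colding, W. P. Minicozzi II, Ann. of Math. 175 (2012), §3; K. Ecker, *Regularity
Theory for Mean Curvature Flow* (2004), Prop. 3.16.
-/

-- the prescribed namespace `Summit.SmoothPoincare4.SmoothPoincare4.…` repeats `SmoothPoincare4`
set_option linter.dupNamespace false

noncomputable section

open Bundle Set Function Filter MeasureTheory Module
open scoped Manifold ContDiff Topology RealInnerProductSpace BigOperators

namespace Summit.SmoothPoincare4.SmoothPoincare4.Cruxes.CylinderRungTwo.KillingFlux

open Literature.Geometry.Riemannian Literature.Geometry.Riemannian.EuclideanHypersurface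
open Literature.Geometry.Lorentzian Literature.Geometry.Lorentzian.PseudoRiemannianMetric
open Literature.Geometry.Riemannian.SphericalCylinderEntropy (truncL truncL_apply)
open Literature.Geometry.Manifold.CylinderSlice (padL padL_apply_castSucc padL_apply_last)

section Identity

variable {M : Type*} [TopologicalSpace M] [ChartedSpace (EuclideanSpace ℝ (Fin 4)) M]
  [IsManifold (𝓡 4) ∞ M] [CompactSpace M] [T2Space M] [MeasurableSpace M] [BorelSpace M]

/-- **The static Gaussian monotonicity identity** on a closed immersed cross-section
`f : M⁴ → N = S⁴ × ℝ ⊂ ℝ⁶` with smooth unit normal `ν` tangent to `N`, mean curvature `H` of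
`(f, ν)`, radial normal `n = (z', 0) ∘ f`, `S = |ν'|²`, `g = f^*δ`, for the Gaussian weight
`G(z) = exp(-|z - x₀|² / (4τ)) / (4πτ)²`, `τ > 0`, `r = f(w) - x₀`:
`∫_M G [ (|r|² - ⟨r,n⟩² - ⟨r,ν⟩²)/(4τ²) - 2/τ + ((4 - S)⟨r,n⟩ + H⟨r,ν⟩)/(2τ) ] dμ_g = 0`.
Green's identity `∫_M Δ_g(G ∘ f) dμ_g = 0` in ambient terms (`integral_sliceLaplacian_eq_zero`) for
`φ = G`, whose integrand collapses pointwise by `helper_gaussianWeight_fderiv`,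
`helper_gaussianWeight_iteratedFDeriv_two`, `helper_gaussianWeight_laplacian` and `|n| = |ν| = 1`.
[cite: Hamilton1993, §4] -/
theorem staticMonotonicity_identity {f νf : M → EuclideanSpace ℝ (Fin 6)}
    (hf : (euclideanMetric (EuclideanSpace ℝ (Fin 6))).IsSpacelikeImmersion (𝓡 4) f)
    (hν : ContMDiff (𝓡 4) 𝓘(ℝ, EuclideanSpace ℝ (Fin 6)) ∞ νf)
    (hun : (euclideanMetric (EuclideanSpace ℝ (Fin 6))).IsUnitNormal (𝓡 4) f νf 1)
    (hN : ∀ x, ∑ i : Fin 5, f x (Fin.castSucc i) ^ 2 = 1)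
    (hνN : ∀ x, ∑ i : Fin 5, νf x (Fin.castSucc i) * f x (Fin.castSucc i) = 0)
    (x₀ : EuclideanSpace ℝ (Fin 6)) {τ : ℝ} (hτ : 0 < τ) :
    ∫ w, (Real.exp (-‖f w - x₀‖ ^ 2 / (4 * τ)) / (4 * Real.pi * τ) ^ 2) *
        ((‖f w - x₀‖ ^ 2 - ⟪f w - x₀, padL (truncL (f w))⟫ ^ 2 - ⟪f w - x₀, νf w⟫ ^ 2) / (4 * τ ^ 2)
          - 2 / τ
          + ((4 - ∑ i : Fin 5, νf w (Fin.castSucc i) ^ 2) * ⟪f w - x₀, padL (truncL (f w))⟫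
            + (euclideanMetric (EuclideanSpace ℝ (Fin 6))).meanCurvature f contMDiff_pullbackBilin_holds
                hf νf w * ⟪f w - x₀, νf w⟫) / (2 * τ))
      ∂riemannianMeasure ((euclideanMetric (EuclideanSpace ℝ (Fin 6))).inducedRiemannianMetric f
        contMDiff_pullbackBilin_holds hf) = 0 := by
  -- Green's identity for `φ = G`
  have h0 := integral_sliceLaplacian_eq_zero hf hν hun hN hνN (helper_gaussianWeight_contDiff x₀ τ hτ)
  -- `|ν| = 1` and `|n| = 1`
  have hνunit : ∀ w, ‖νf w‖ = 1 := fun w => by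
    have h : ⟪νf w, νf w⟫ = (1 : ℝ) := by
      have := hun.val_self w
      rwa [euclideanMetric_apply] at this
    rw [real_inner_self_eq_norm_sq] at h
    nlinarith [norm_nonneg (νf w)]
  have hrad := isUnitNormal_radial hf.contMDiff_self hN
  have hnunit : ∀ w, ‖padL (truncL (f w))‖ = 1 := fun w => by
    have h : ⟪padL (truncL (f w)), padL (truncL (f w))⟫ = (1 : ℝ) := by
      have := hrad.val_self w
      rwa [euclideanMetric_apply] at this
    rw [real_inner_self_eq_norm_sq] at h
    nlinarith [norm_nonneg (padL (truncL (f w)))]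
  -- the integrand, pointwise (`H`, `S` stand for the mean curvature and `|ν'|²`)
  have hpt : ∀ (w) (H S : ℝ),
      (((∑ j : Fin 6, iteratedFDeriv ℝ 2
              (fun z : EuclideanSpace ℝ (Fin 6) => Real.exp (-‖z - x₀‖ ^ 2 / (4 * τ)) / (4 * Real.pi * τ) ^ 2)
              (f w) ![EuclideanSpace.single j (1 : ℝ), EuclideanSpace.single j (1 : ℝ)])
            - iteratedFDeriv ℝ 2
                (fun z : EuclideanSpace ℝ (Fin 6) => Real.exp (-‖z - x₀‖ ^ 2 / (4 * τ)) / (4 * Real.pi * τ) ^ 2)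
                (f w) ![padL (truncL (f w)), padL (truncL (f w))]
            - 4 * fderiv ℝ
                (fun z : EuclideanSpace ℝ (Fin 6) => Real.exp (-‖z - x₀‖ ^ 2 / (4 * τ)) / (4 * Real.pi * τ) ^ 2)
                (f w) (padL (truncL (f w))))
          - (iteratedFDeriv ℝ 2
                (fun z : EuclideanSpace ℝ (Fin 6) => Real.exp (-‖z - x₀‖ ^ 2 / (4 * τ)) / (4 * Real.pi * τ) ^ 2)
                (f w) ![νf w, νf w]
            - S * fderiv ℝ
                (fun z : EuclideanSpace ℝ (Fin 6) => Real.exp (-‖z - x₀‖ ^ 2 / (4 * τ)) / (4 * Real.pi * τ) ^ 2)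
                (f w) (padL (truncL (f w))))
          - H * fderiv ℝ
                (fun z : EuclideanSpace ℝ (Fin 6) => Real.exp (-‖z - x₀‖ ^ 2 / (4 * τ)) / (4 * Real.pi * τ) ^ 2)
                (f w) (νf w))
        = (Real.exp (-‖f w - x₀‖ ^ 2 / (4 * τ)) / (4 * Real.pi * τ) ^ 2) *
            ((‖f w - x₀‖ ^ 2 - ⟪f w - x₀, padL (truncL (f w))⟫ ^ 2 - ⟪f w - x₀, νf w⟫ ^ 2) / (4 * τ ^ 2)
              - 2 / τ
              + ((4 - S) * ⟪f w - x₀, padL (truncL (f w))⟫ + H * ⟪f w - x₀, νf w⟫) / (2 * τ)) := by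
    intro w H S
    rw [helper_gaussianWeight_laplacian x₀ τ hτ, helper_gaussianWeight_iteratedFDeriv_two x₀ τ hτ,
      helper_gaussianWeight_iteratedFDeriv_two x₀ τ hτ, helper_gaussianWeight_fderiv x₀ τ hτ,
      helper_gaussianWeight_fderiv x₀ τ hτ, hνunit w, hnunit w]
    ring
  exact (integral_congr_ae (Eventually.of_forall fun w => (hpt w _ _).symm)).trans h0

end Identity

/-- **Registered helper `helper_staticMonotonicityIdentity` of line `killing-flux` (the static
Gaussian monotonicity identity, Green's identity for the Gaussian weight on a closed cross-section
of `N = S⁴ × ℝ`).** For a closed immersed cross-section `f : M⁴ → N` with smooth unit normal `ν`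
tangent to `N`, mean curvature `H` of `(f, ν)`, radial normal `n = (z', 0) ∘ f`, `S = |ν'|²`,
`G(z) = exp(-|z - x₀|² / (4τ)) / (4πτ)²`, `τ > 0`, `r = f(w) - x₀`:
`∫_M G [ (|r|² - ⟨r,n⟩² - ⟨r,ν⟩²)/(4τ²) - 2/τ + ((4 - S)⟨r,n⟩ + H⟨r,ν⟩)/(2τ) ] dμ_g = 0`
(`staticMonotonicity_identity`). [cite: Hamilton1993, §4] -/
theorem helper_staticMonotonicityIdentity : ∀ (M : Type) [TopologicalSpace M] [ChartedSpace (EuclideanSpace ℝ (Fin 4)) M] [IsManifold (𝓡 4) ∞ M] [CompactSpace M] [T2Space M] [MeasurableSpace M] [BorelSpace M] (f νf : M → EuclideanSpace ℝ (Fin 6)) (hf : (Literature.Geometry.Riemannian.euclideanMetric (EuclideanSpace ℝ (Fin 6))).IsSpacelikeImmersion (𝓡 4) f), ContMDiff (𝓡 4) (𝓡 6) ∞ νf → (Literature.Geometry.Riemannian.euclideanMetric (EuclideanSpace ℝ (Fin 6))).IsUnitNormal (𝓡 4) f νf 1 → (∀ x, ∑ i : Fin 5, f x (Fin.castSucc i)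 ^ 2 = 1) → (∀ x, ∑ i : Fin 5, νf x (Fin.castSucc i) * f x (Fin.castSucc i) = 0) → ∀ (x₀ : EuclideanSpace ℝ (Fin 6)) (τ : ℝ), 0 < τ → ∫ w, (Real.exp (-‖f w - x₀‖ ^ 2 / (4 * τ)) / (4 * Real.pi * τ) ^ 2) * ((‖f w - x₀‖ ^ 2 - inner ℝ (f w - x₀) (Literature.Geometry.Manifold.CylinderSlice.padL (Literature.Geometry.Riemannian.SphericalCylinderEntropy.truncL (f w))) ^ 2 - inner ℝ (f w - x₀) (νf w) ^ 2) / (4 * τ ^ 2) - 2 / τ + ((4 - ∑ i : Fin 5, νf w (Fin.castSucc i) ^ 2) * inner ℝ (f w - x₀) (Literature.Geometry.Manifold.CylinderSlice.padL (Literature.Geometry.Riemannian.SphericalCylinderEntropy.truncL (f w))) + (Literature.Geometry.Riemannian.euclideanMetric (EuclideanSpace ℝ (Fin 6))).meanCurvature f Literature.Geometry.Lorentzian.PseudoRiemannianMetric.contMDiff_pullbackBilin_holds hf νf w * inner ℝ (f w - x₀) (νf w)) / (2 * τ)) ∂Literature.Geometry.Lorentzian.riemannianMeasure ((Literature.Geometry.Riemannian.euclideanMetric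 (EuclideanSpace ℝ (Fin 6))).inducedRiemannianMetric f Literature.Geometry.Lorentzian.PseudoRiemannianMetric.contMDiff_pullbackBilin_holds hf) = 0 := by
  intro M _ _ _ _ _ _ _ f νf hf hν hun hN hνN x₀ τ hτ
  exact staticMonotonicity_identity hf hν hun hN hνN x₀ hτ

end Summit.SmoothPoincare4.SmoothPoincare4.Cruxes.CylinderRungTwo.KillingFlux

end
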